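import Summits.QuantumFields.YangMills.Theorems.F4SubCurvatureDoorFibreDichotomyHarmonicMomentODE
import Mathlib
import HarnessLib

/-!
# LINE g21-B «fibre dichotomy» (⟨stmt-QuantumFields-23125⟩) — B4 helper: harmonic homogeneous polynomials under linear
# isometries of `ℝ⁴`, and invariant integrals (stub plan step H6, algebraic half)

Helper toward the registered stub B4 `stub_singleShellDichotomy` (stub plan `Lines/fibre_dichotomy_stubplans.md`, H6).  For a linear
isometry `R` of `ℝ⁴` the substitution `Y ↦ Y ∘ R` is realised on `MvPolynomial (Fin 4) ℝ` by
`MvPolynomial.aeval (fun i => Σ_j (R e_j)_i • X_j)`; it evaluates as composition (`toFun_aevalIso`), preserves homogeneity of every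
degree (`isHomogeneous_aevalIso`) and commutes with the polynomial Laplacian (`lap_aevalIso`, through the invariance of Mathlib's
Laplacian under linear isometries, `laplacian_comp_linearIsometryEquiv`).  Integrals over balls and shells against Lebesgue measure are
invariant under `R` (`setIntegral_comp_iso_of_preimage_eq`), and a non-zero homogeneous polynomial has `∫_{B(0,1)} Y² dx > 0`
(`integral_ball_sq_pos`).

Mathlib + tree only; no `sorry`; no new definitions.  HONEST LABEL: algebra/analysis helper for a registered stub of an OPEN line; B4, B5,
S1, S2, ⟨23125⟩, ⟨23035⟩, R2d and the Yang–Mills mass gap remain OPEN; no summit is proved by a line.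
-/

noncomputable section

open MeasureTheory MeasureTheory.Measure Set Function Filter Topology Metric Module InnerProductSpace
open scoped RealInnerProductSpace ContDiff Laplacian BigOperators

namespace Summit.QuantumFields.YangMills.Theorems.F4SubCurvatureDoorHarmonicMomentODE

open MvPolynomial (aeval X C pderiv)
open Literature.Analysis.Calculus.MvPoly (toFun lap contDiff_toFun toFun_smul_of_isHomogeneous toFun_mul toFun_add toFun_sum toFun_smul
  toFun_X toFun_C)
open Summit.QuantumFields.YangMills.Theorems.F4SubCurvatureDoorLaplaceFourierRegistered (E4)

/-! ## Coordinates -/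

/-- Expansion of a point of `ℝ⁴` in the coordinate frame. -/
theorem sum_coord_smul_single (x : E4) : ∑ j : Fin 4, x j • EuclideanSpace.single j (1 : ℝ) = x := by
  ext i
  simp [Finset.sum_apply, Pi.single_apply, Finset.sum_ite_eq]

/-- Coordinates of the image under a linear isometry: `(R x)_i = Σ_j x_j (R e_j)_i`. -/
theorem iso_apply_coord (R : E4 ≃ₗᵢ[ℝ] E4) (x : E4) (i : Fin 4) :
    (R x) i = ∑ j : Fin 4, x j * (R (EuclideanSpace.single j (1 : ℝ))) i := by
  conv_lhs => rw [← sum_coord_smul_single x]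
  simp [_root_.map_sum, Finset.sum_apply]

/-! ## The substitution `Y ↦ Y ∘ R` on polynomials -/

/-- **Evaluation of the substituted polynomial is composition with `R`.** -/
theorem toFun_aevalIso (R : E4 ≃ₗᵢ[ℝ] E4) (Q : MvPolynomial (Fin 4) ℝ) (x : E4) :
    toFun (aeval (fun i : Fin 4 => ∑ j : Fin 4, (R (EuclideanSpace.single j (1 : ℝ))) i • (X j : MvPolynomial (Fin 4) ℝ)) Q) x = toFun Q (R x) := by
  induction Q using MvPolynomial.induction_on with
  | C a => simp [toFun]
  | add p q hp hq => rw [map_add, toFun_add, toFun_add, hp, hq]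
  | mul_X p n hp =>
    rw [map_mul, toFun_mul, toFun_mul, hp, MvPolynomial.aeval_X, toFun_X, iso_apply_coord, toFun_sum]
    congr 1
    refine Finset.sum_congr rfl fun j _ => ?_
    rw [toFun_smul, toFun_X, mul_comm]

/-- The substituted polynomial of a homogeneous polynomial is homogeneous of the same degree. -/
theorem isHomogeneous_aevalIso (R : E4 ≃ₗᵢ[ℝ] E4) {Q : MvPolynomial (Fin 4) ℝ} {L : ℕ} (hQ : Q.IsHomogeneous L) :
    (aeval (fun i : Fin 4 => ∑ j : Fin 4, (R (EuclideanSpace.single j (1 : ℝ))) i • (X j : MvPolynomial (Fin 4) ℝ)) Q).IsHomogeneous L := by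
  have hg : ∀ i : Fin 4,
      (∑ j : Fin 4, (R (EuclideanSpace.single j (1 : ℝ))) i • (X j : MvPolynomial (Fin 4) ℝ)).IsHomogeneous 1 := by
    intro i
    refine MvPolynomial.IsHomogeneous.sum _ _ _ fun j _ => ?_
    rw [MvPolynomial.smul_eq_C_mul]
    simpa using (MvPolynomial.isHomogeneous_C (Fin 4) ((R (EuclideanSpace.single j (1 : ℝ))) i)).mul
      (MvPolynomial.isHomogeneous_X ℝ j)
  have h := hQ.aeval _ hg
  rwa [one_mul] at h

/-- **The Laplacian is invariant under linear isometries**: `Δ (f ∘ R) x = (Δ f) (R x)` (any `f`; the formula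
`Δ f = Σᵢ D²f(bᵢ, bᵢ)` holds for every orthonormal basis, in particular for the image basis `R b`). -/
theorem laplacian_comp_linearIsometryEquiv (R : E4 ≃ₗᵢ[ℝ] E4) (f : E4 → ℝ) (x : E4) :
    (Δ (f ∘ R)) x = (Δ f) (R x) := by
  set b := EuclideanSpace.basisFun (Fin 4) ℝ
  rw [laplacian_eq_iteratedFDeriv_orthonormalBasis (f ∘ R) b, laplacian_eq_iteratedFDeriv_orthonormalBasis f (b.map R)]
  refine Finset.sum_congr rfl fun i _ => ?_
  have hcomp := R.toContinuousLinearEquiv.iteratedFDerivWithin_comp_right f uniqueDiffOn_univ (x := x) (Set.mem_univ _) 2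
  rw [Set.preimage_univ, iteratedFDerivWithin_univ, iteratedFDerivWithin_univ] at hcomp
  have e : (f ∘ ⇑R) = f ∘ ⇑(R.toContinuousLinearEquiv) := rfl
  rw [e, hcomp, ContinuousMultilinearMap.compContinuousLinearMap_apply]
  congr 1
  funext j
  fin_cases j <;> simp [b]

/-- **The polynomial Laplacian commutes with isometric substitutions**: `lap (Y ∘ R) = (lap Y) ∘ R`. -/
theorem lap_aevalIso (R : E4 ≃ₗᵢ[ℝ] E4) (Q : MvPolynomial (Fin 4) ℝ) :
    lap (aeval (fun i : Fin 4 => ∑ j : Fin 4, (R (EuclideanSpace.single j (1 : ℝ))) i • (X j : MvPolynomial (Fin 4) ℝ)) Q) =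
      aeval (fun i : Fin 4 => ∑ j : Fin 4, (R (EuclideanSpace.single j (1 : ℝ))) i • (X j : MvPolynomial (Fin 4) ℝ)) (lap Q) := by
  -- both sides define the same polynomial FUNCTION
  have hfun : ∀ x : E4, toFun (lap (aeval (fun i : Fin 4 => ∑ j : Fin 4, (R (EuclideanSpace.single j (1 : ℝ))) i • (X j : MvPolynomial (Fin 4) ℝ)) Q)) x =
      toFun (aeval (fun i : Fin 4 => ∑ j : Fin 4, (R (EuclideanSpace.single j (1 : ℝ))) i • (X j : MvPolynomial (Fin 4) ℝ)) (lap Q)) x := by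
    intro x
    have e : toFun (aeval (fun i : Fin 4 => ∑ j : Fin 4, (R (EuclideanSpace.single j (1 : ℝ))) i • (X j : MvPolynomial (Fin 4) ℝ)) Q) = toFun Q ∘ R :=
      funext fun y => toFun_aevalIso R Q y
    rw [← laplacian_toFun_eq, e, laplacian_comp_linearIsometryEquiv, laplacian_toFun_eq, toFun_aevalIso]
  refine MvPolynomial.funext fun y => ?_
  have h := hfun (WithLp.toLp 2 y)
  simpa [toFun] using h

/-- A harmonic polynomial stays harmonic under isometric substitution. -/
theorem lap_aevalIso_eq_zero (R : E4 ≃ₗᵢ[ℝ] E4) {Q : MvPolynomial (Fin 4) ℝ} (hQ : lap Q = 0) :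
    lap (aeval (fun i : Fin 4 => ∑ j : Fin 4, (R (EuclideanSpace.single j (1 : ℝ))) i • (X j : MvPolynomial (Fin 4) ℝ)) Q) = 0 := by
  rw [lap_aevalIso, hQ, map_zero]

/-! ## Invariant integrals -/

/-- Linear isometries preserve Lebesgue measure and sets defined by the norm: `∫_{s} g (R x) dx = ∫_{s} g dx` whenever `R ⁻¹' s = s`. -/
theorem setIntegral_comp_iso_of_preimage_eq (R : E4 ≃ₗᵢ[ℝ] E4) (g : E4 → ℝ) {s : Set E4} (hs : R ⁻¹' s = s) :
    ∫ x in s, g (R x) = ∫ x in s, g x := by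
  have h := (R.measurePreserving).setIntegral_preimage_emb R.toMeasurableEquiv.measurableEmbedding g s
  rwa [hs] at h

/-- Balls about the origin are invariant under linear isometries. -/
theorem iso_preimage_ball (R : E4 ≃ₗᵢ[ℝ] E4) (ρ : ℝ) : R ⁻¹' ball (0 : E4) ρ = ball 0 ρ := by
  ext x
  simp [mem_ball, dist_zero_right]

/-- Shells about the origin are invariant under linear isometries. -/
theorem iso_preimage_shell (R : E4 ≃ₗᵢ[ℝ] E4) (a b : ℝ) :
    R ⁻¹' {x : E4 | a < ‖x‖ ∧ ‖x‖ < b} = {x : E4 | a < ‖x‖ ∧ ‖x‖ < b} := by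
  ext x
  simp

/-! ## Integrability of polynomial functions on bounded sets and positivity -/

/-- Polynomial functions are integrable on the unit ball. -/
theorem integrableOn_toFun_mul_ball (P Q : MvPolynomial (Fin 4) ℝ) :
    IntegrableOn (fun x : E4 => toFun P x * toFun Q x) (ball (0 : E4) 1) volume :=
  ((((contDiff_toFun (m := 0) P).continuous.mul (contDiff_toFun (m := 0) Q).continuous).continuousOn).integrableOn_compact
    (isCompact_closedBall (0 : E4) 1)).mono_set ball_subset_closedBall

/-- **A non-zero homogeneous polynomial has positive square integral over the unit ball.** -/
theorem integral_ball_sq_pos {Q : MvPolynomial (Fin 4) ℝ} {L : ℕ} (hQ : Q.IsHomogeneous L) (hQ0 : Q ≠ 0) :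
    0 < ∫ x in ball (0 : E4) 1, toFun Q x * toFun Q x := by
  have hc : Continuous (toFun Q) := (contDiff_toFun (m := 0) Q).continuous
  -- some point of the unit sphere where `Q ≠ 0`, hence a point of the ball
  by_contra hle
  have hint := integrableOn_toFun_mul_ball Q Q
  have hzero : ∫ x in ball (0 : E4) 1, toFun Q x * toFun Q x = 0 :=
    le_antisymm (not_lt.1 hle) (setIntegral_nonneg measurableSet_ball fun x _ => mul_self_nonneg _)
  -- the support of `Q²` meets the ball in a null set, hence (open) in the empty set
  have hsupp : volume (Function.support (fun x : E4 => toFun Q x * toFun Q x) ∩ ball (0 : E4) 1) = 0 := by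
    have h := (setIntegral_pos_iff_support_of_nonneg_ae (Eventually.of_forall fun x => mul_self_nonneg (toFun Q x)) hint).not
    rw [hzero, lt_self_iff_false, not_false_eq_true, true_iff, not_lt] at h
    exact le_antisymm h zero_le
  have hopen : IsOpen (Function.support (fun x : E4 => toFun Q x * toFun Q x) ∩ ball (0 : E4) 1) :=
    ((hc.mul hc).isOpen_support).inter isOpen_ball
  have hempty := (hopen.measure_eq_zero_iff volume).1 hsupp
  -- so `Q` vanishes on the ball, hence everywhere by homogeneity, hence `Q = 0`
  have hball : ∀ x : E4, ‖x‖ < 1 → toFun Q x = 0 := by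
    intro x hx
    by_contra h
    have hmem : x ∈ Function.support (fun x : E4 => toFun Q x * toFun Q x) ∩ ball (0 : E4) 1 :=
      ⟨by simpa [Function.mem_support] using h, by simpa [mem_ball, dist_zero_right] using hx⟩
    rw [hempty] at hmem
    exact hmem
  have hall : ∀ x : E4, toFun Q x = 0 := by
    intro x
    set t : ℝ := 1 / (2 * (‖x‖ + 1)) with ht
    have htpos : 0 < t := by positivity
    have hnorm : ‖t • x‖ < 1 := by
      rw [norm_smul, Real.norm_eq_abs, abs_of_pos htpos, ht]
      rw [div_mul_eq_mul_div, one_mul, div_lt_one (by positivity)]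
      nlinarith [norm_nonneg x]
    have h := toFun_smul_of_isHomogeneous hQ t x
    rw [hball _ hnorm] at h
    exact (mul_eq_zero.1 h.symm).resolve_left (pow_ne_zero _ htpos.ne')
  refine hQ0 (MvPolynomial.funext fun y => ?_)
  have h := hall (WithLp.toLp 2 y)
  simpa [toFun] using h

end Summit.QuantumFields.YangMills.Theorems.F4SubCurvatureDoorHarmonicMomentODE

end
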